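import Summits.BirchSwinnertonDyer.BirchSwinnertonDyer.Theorems.PrintCf2RubinValueTwoRayClassNumberFormula
import Literature.NumberTheory.GaloisRepresentations.RayClassGroupPrimePowerKernel
import Literature.NumberTheory.NumberFields.RayClassFieldGaloisGroup
import Mathlib.Data.Nat.Totient
import HarnessLib

/-!
# Brick (c) at `p = 2`, tame theta families, degrees: `[K(𝔣𝔭^{a+2}) : K] = p·[K(𝔣𝔭^{a+1}) : K]` for a degree-one unramified `𝔭`, `𝔣` prime to `𝔭`,
# ASSUMING ONLY `w_{𝔣𝔭^{a+1}} = 1` (not `w_{𝔣𝔭} = 1`) — via de Shalit's class number formula `#Cl^𝔪·w_K = h_K·#(𝒪/𝔪)ˣ` and `#(𝒪/𝔣𝔭^b)ˣ = #(𝒪/𝔣)ˣ·φ(p^b)`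

Cell `bsd-print-cf2`, width seat `bsd-line-cf2c-w7` g29, route C `PrintCf2RubinValueTwo`, crux of record stmt-BirchSwinnertonDyer-24033
`TwoVariableMainConjAtSplitTwoQuad` (23720 nominal), BRICK §4(c); memo v11 `Cruxes/TwoVariableMainConjAtSplitTwoQuad/BRICK-C-D4CHI-g29.md` §3.  `--supports` the
crux as a helper.  The tree's `finrank_rayClassField_mul_pow_succ_succ_eq` (`…BrickCD4ChiLayerDegrees`) needs `w_{𝔣𝔭} = 1` at the BOTTOM of the `𝔭`-tower; for
the tame theta fields `K(𝔡v̄^a v^b)` with `𝔡 = 𝒪_K`, `b = 1` this fails (`−1 ≡ 1 mod v v̄ = (2)`), although every level `a ≥ 2` is rigid.  This file proves the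
one-step degree formula under rigidity of the LOWER of the two levels only.

* `natCard_units_quotient_mul_eq` — `#(𝒪/𝔣𝔞)ˣ = #(𝒪/𝔣)ˣ·#(𝒪/𝔞)ˣ` for coprime `𝔣, 𝔞` (CRT).
* `natCard_units_quotient_pow_succ_eq` — `#(𝒪/𝔭^{b+1})ˣ = p^b·(p−1)` for `𝔭` of degree one unramified over `p` (`𝒪/𝔭^{b+1} ≅ ℤ/p^{b+1}`).
* ★ `finrank_rayClassField_mul_pow_succ_succ_eq_of_rigid` — `[K(𝔣𝔭^{a+2}):K] = p·[K(𝔣𝔭^{a+1}):K]` if no unit `≠ 1` is `≡ 1 (mod 𝔣𝔭^{a+1})`.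
THEOREMS ONLY (0 sorry, no definition, no named fact).  BSD is not proved by any of this; nothing here closes 24033 or 27037.

## References
* [deShalit1987] E. de Shalit, *Iwasawa theory of elliptic curves with complex multiplication* (1987), II.1.9 (p. 43).
* [NeukirchANT1999] J. Neukirch, *Algebraic Number Theory* (1999), Ch. VI §1 Prop. (1.11), §6 Def. (6.2); Ch. I §8 Prop. (8.3).
-/

noncomputable section

set_option linter.dupNamespace false
set_option autoImplicit false

open scoped NumberField Classical
open NumberField IsDedekindDomain IsDedekindDomain.HeightOneSpectrum
open Literature.NumberTheory.NumberFields Literature.NumberTheory.GaloisRepresentations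
open Literature.NumberTheory.ComplexMultiplication.EllipticUnits

namespace Summit.BirchSwinnertonDyer.BirchSwinnertonDyer.Theorems.PrintCf2.BrickCD4Chi

variable {K : Type} [Field K] [NumberField K]

omit [NumberField K] in
/-- `#(𝒪/𝔣𝔞)ˣ = #(𝒪/𝔣)ˣ · #(𝒪/𝔞)ˣ` for coprime ideals `𝔣, 𝔞` (Chinese remainder theorem on units). [cite: NeukirchANT1999, Ch. VI §1 Prop. (1.11)] -/
theorem natCard_units_quotient_mul_eq {𝔣 𝔞 : Ideal (𝓞 K)} (h : IsCoprime 𝔣 𝔞) :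
    Nat.card (𝓞 K ⧸ 𝔣 * 𝔞)ˣ = Nat.card (𝓞 K ⧸ 𝔣)ˣ * Nat.card (𝓞 K ⧸ 𝔞)ˣ := by
  rw [← Nat.card_prod]
  exact Nat.card_congr ((Units.mapEquiv (Ideal.quotientMulEquivQuotientProd 𝔣 𝔞 h).toMulEquiv).trans MulEquiv.prodUnits).toEquiv

/-- `#(𝒪/𝔭^{b+1})ˣ = p^b·(p−1)` for a prime `𝔭` of degree one unramified over `p` (`𝒪/𝔭^{b+1} ≅ ℤ/p^{b+1}`, Euler's `φ`).
[cite: NeukirchANT1999, Ch. I §8 Prop. (8.3)] [cite: deShalit1987, II.1.9 (p. 43)] -/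
theorem natCard_units_quotient_pow_succ_eq (v : HeightOneSpectrum (𝓞 K)) {p : ℕ} [hp : Fact p.Prime] (hdeg : Nat.card (𝓞 K ⧸ v.asIdeal) = p)
    (hval : v.intValuation ((p : ℕ) : 𝓞 K) = WithZero.exp (-1 : ℤ)) (b : ℕ) :
    Nat.card (𝓞 K ⧸ v.asIdeal ^ (b + 1))ˣ = p ^ b * (p - 1) := by
  obtain ⟨e⟩ := nonempty_ringEquiv_zmod_quotient_pow v hdeg hval (b + 1)
  rw [← Nat.card_congr (Units.mapEquiv e.toMulEquiv).toEquiv, Nat.card_eq_fintype_card, ZMod.card_units_eq_totient,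
    Nat.totient_prime_pow_succ hp.out]

/-- ★ **`[K(𝔣𝔭^{a+2}) : K] = p·[K(𝔣𝔭^{a+1}) : K]`** for `K` totally complex, `𝔭` of degree one unramified over `p`, `𝔣 ≠ 0` prime to `𝔭`, under the rigidity
of the LOWER level only: no unit `≠ 1` is `≡ 1 (mod 𝔣𝔭^{a+1})`.  (`[K(𝔪):K]·w_K = h_K·#(𝒪/𝔪)ˣ` for rigid `𝔪`, and `#(𝒪/𝔣𝔭^{b+1})ˣ = #(𝒪/𝔣)ˣ·p^b(p−1)`.)
[cite: deShalit1987, II.1.9 (p. 43)] [cite: NeukirchANT1999, Ch. VI §1 Prop. (1.11), §6 Def. (6.2)] -/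
theorem finrank_rayClassField_mul_pow_succ_succ_eq_of_rigid [IsTotallyComplex K] (v : HeightOneSpectrum (𝓞 K)) {p : ℕ} [hp : Fact p.Prime]
    (hdeg : Nat.card (𝓞 K ⧸ v.asIdeal) = p) (hval : v.intValuation ((p : ℕ) : 𝓞 K) = WithZero.exp (-1 : ℤ)) {𝔣 : Ideal (𝓞 K)} (h𝔣 : 𝔣 ≠ ⊥)
    (hcop : IsCoprime 𝔣 v.asIdeal) (a : ℕ) (hw : ∀ u : (𝓞 K)ˣ, (u : 𝓞 K) - 1 ∈ 𝔣 * v.asIdeal ^ (a + 1) → u = 1) :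
    Module.finrank K (rayClassField K (𝔣 * v.asIdeal ^ (a + 2))) = p * Module.finrank K (rayClassField K (𝔣 * v.asIdeal ^ (a + 1))) := by
  have h1 : 𝔣 * v.asIdeal ^ (a + 1) ≠ ⊥ := mul_ne_zero h𝔣 (pow_ne_zero _ v.ne_bot)
  have h2 : 𝔣 * v.asIdeal ^ (a + 2) ≠ ⊥ := mul_ne_zero h𝔣 (pow_ne_zero _ v.ne_bot)
  have hw2 : ∀ u : (𝓞 K)ˣ, (u : 𝓞 K) - 1 ∈ 𝔣 * v.asIdeal ^ (a + 2) → u = 1 :=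
    fun u hu ↦ hw u (Ideal.mul_mono_right (Ideal.pow_le_pow_right (Nat.le_succ _)) hu)
  have e1 := RayClassNumberFormula.natCard_rayClassGroup_mul_natCard_units_of_forall_units h1 hw
  have e2 := RayClassNumberFormula.natCard_rayClassGroup_mul_natCard_units_of_forall_units h2 hw2
  rw [natCard_units_quotient_mul_eq (hcop.pow_right), natCard_units_quotient_pow_succ_eq v hdeg hval] at e1 e2
  rw [finrank_rayClassField h2, finrank_rayClassField h1]
  -- the units inject into the finite group `(𝒪/𝔣𝔭^{a+1})ˣ`, hence are finite
  haveI : Finite (𝓞 K ⧸ 𝔣 * v.asIdeal ^ (a + 1)) := Ideal.finiteQuotientOfFreeOfNeBot _ h1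
  have hinj : Function.Injective (Units.map (Ideal.Quotient.mk (𝔣 * v.asIdeal ^ (a + 1))).toMonoidHom : (𝓞 K)ˣ →* (𝓞 K ⧸ 𝔣 * v.asIdeal ^ (a + 1))ˣ) := by
    rw [injective_iff_map_eq_one]
    intro u hu
    refine hw u ?_
    rw [← Ideal.Quotient.eq, map_one]
    have hu' := congrArg (fun x : (𝓞 K ⧸ 𝔣 * v.asIdeal ^ (a + 1))ˣ ↦ (x : 𝓞 K ⧸ 𝔣 * v.asIdeal ^ (a + 1))) hu
    simpa using hu'
  haveI : Finite (𝓞 K)ˣ := Finite.of_injective _ hinj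
  have hwpos : 0 < Nat.card (𝓞 K)ˣ := Nat.card_pos
  have key : Nat.card (RayClassGroup (𝔣 * v.asIdeal ^ (a + 2))) * Nat.card (𝓞 K)ˣ =
      (p * Nat.card (RayClassGroup (𝔣 * v.asIdeal ^ (a + 1)))) * Nat.card (𝓞 K)ˣ := by
    rw [e2, mul_assoc, e1, pow_succ]
    ring
  exact Nat.eq_of_mul_eq_mul_right hwpos key

end Summit.BirchSwinnertonDyer.BirchSwinnertonDyer.Theorems.PrintCf2.BrickCD4Chi

end
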